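/-
Copyright: the b2b-balaban T⁴-continuum CRUX team, row NE7b, leaf prover `t4-ne7b-formalise-leaf-01` (gen 79), junction of its
`LogConcaveDominatedMoment` with the OWNER lineage `t4-ne7b-p1` (gen 106)'s `LocalPerturbationSandwich`. Project licence.
-/
import Summits.QuantumFields.BalabanUV.T4Continuum.Spine.NE7b.LogConcaveDominatedMoment
import Summits.QuantumFields.BalabanUV.T4Continuum.Spine.NE7b.LocalPerturbationSandwich

/-!
# THE ZERO-COST CLASS TIMES THE SANDWICH: an even log-concave factor (free) times a small near remainder `e^{−V}`, `|V| ≤ v` on the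
# support (price `e^{2v}`) — the two (R2) kernel shares composed BY NAME (row NE7b, node U5c; model level)

Cell `pub-balaban`, sub-cell `t4`, spine estimate NE7b (`T4WeightBudget.RelWeightBound` — the cell's OWN estimate, NOT PRINTED in
[Bałaban 1983–89], NOT PROVED).  Crux-route MODEL work under `Spine/NE7b/`; no `T4Continuum/Support` leaf, no `Prop` minted, nothing of
[B15]∕[B16] named; 0 `sorry`.

WHAT.  For the one-step density `F·e^{−V}·e^{−xᵀSx}` with `F ≥ 0` measurable, EVEN and MIDPOINT-LOG-CONCAVE (symmetric convex small-field
restriction × even convex part of the remainder — `LogConcaveDominatedMoment`) and a measurable `V` with `|V x| ≤ v` wherever `F x ≠ 0`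
(the odd ∕ non-convex NEAR part of the remainder, by value — the OWNER's `LocalPerturbationSandwich`), the sacrificed `δ`-dominated
rank-`≤ r` form costs `e^{2v}·(√(1−δ))⁻¹ ^ r` in the density's OWN normalisation (`logConcaveSandwichMoment_le`), and the carrier of
such kernels is background-uniformly bounded by `e^{2v + r·(−log(1−δ)∕2)}` (`logConcaveSandwichCarrier_le`, the `hM0∕hMb` input of
`GaussianDominatedMoment.locCondStability_of_carrier_le`).  Proof: `LogConcaveDominatedMoment.logConcaveMoment_le` is the `hmom` of the
OWNER's `LocalPerturbationSandwich.integral_le_of_sandwich`, the pointwise sandwich is his `mul_exp_neg_sandwich`.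

NOT HERE (honest).  The far ∕ fibrewise frame (the OWNER's `perturbedMoment_le_of_shifted_fibres`: there the fibre Gaussian is centred at
the induced mean `−m(x₂)` while `F` is centred at `0`, so the zero-cost comparison needs (R1″)'s induced-mean control first); by-value
bounds `v` for Bałaban's local terms ((R2′)); the identification (A3).  BY-NAME EFFECT ON THE WALL: NONE.  NE7b NOT PRINTED ∕ NOT PROVED;
spine PROVED 0∕9; rung (B)+1 on a FINITE torus — NOT infinite volume, NOT the mass gap, NOT Clay.
HONEST DEPENDENCY: continuum YM on T⁴ ⇐ BetaPertH ∧ nine spine estimates (0/9 proved); BetaPertH ⇐ (D1) ∧ (D4) ∧ CAP+tail;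
G-an2-4 gates asym, D1 and NE2/3/4.
-/

set_option autoImplicit false

open MeasureTheory Real Matrix Finset
open Summit.QuantumFields.BalabanUV.T4Continuum.NE7b.GaussianDominatedMoment
open Summit.QuantumFields.BalabanUV.T4Continuum.NE7b.GaussianRestrictedMoment
open Summit.QuantumFields.BalabanUV.T4Continuum.NE7b.LogConcaveDominatedMoment
open Summit.QuantumFields.BalabanUV.T4Continuum.NE7b.LocalPerturbationSandwich

namespace Summit.QuantumFields.BalabanUV.T4Continuum.NE7b.LogConcaveSandwich

variable {n : Type*} [Fintype n] [DecidableEq n]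

/-- **ZERO-COST CLASS × SANDWICH.**  `S` positive definite, `Q` positive semidefinite, `Q ≤ δS` (`0 ≤ δ < 1`), `rank Q ≤ r`; `F ≥ 0`
measurable, even, midpoint-log-concave; `V` measurable with `|V x| ≤ v` wherever `F x ≠ 0`.  Then
`∫ F·e^{−V}·e^{xᵀQx}·e^{−xᵀSx} ≤ e^{2v}·(√(1−δ))⁻¹ ^ r · ∫ F·e^{−V}·e^{−xᵀSx}`. [folklore] -/
theorem logConcaveSandwichMoment_le {S Q : Matrix n n ℝ} {δ v : ℝ} {r : ℕ} (hS : S.PosDef) (hQ : Q.PosSemidef)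
    (hdom : (δ • S - Q).PosSemidef) (hδ0 : 0 ≤ δ) (hδ : δ < 1) (hr : Q.rank ≤ r) {F V : (n → ℝ) → ℝ} (hF0 : ∀ x, 0 ≤ F x)
    (hFm : Measurable F) (hFe : ∀ x, F (-x) = F x) (hFlc : ∀ x y, F x * F y ≤ F ((2 : ℝ)⁻¹ • (x + y)) ^ 2)
    (hVm : Measurable V) (hV : ∀ x, F x ≠ 0 → |V x| ≤ v) :
    ∫ x, F x * exp (-V x) * (exp (x ⬝ᵥ (Q *ᵥ x)) * exp (-(x ⬝ᵥ (S *ᵥ x)))) ≤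
      (exp (2 * v) * (√(1 - δ))⁻¹ ^ r) * ∫ x, F x * exp (-V x) * exp (-(x ⬝ᵥ (S *ᵥ x))) := by
  have hFb : ∀ x, ‖F x‖ ≤ F 0 := fun x => by
    rw [Real.norm_eq_abs, abs_of_nonneg (hF0 _)]; exact le_zero_of_evenLogConcave hF0 hFe hFlc _
  -- the sandwich on the support of `F`
  have hsw : ∀ x, F x * exp (-V x) ≤ exp v * F x ∧ F x ≤ exp v * (F x * exp (-V x)) :=
    fun x => mul_exp_neg_sandwich (hF0 x) (hV x)
  -- `F·e^{−V}` is bounded by `e^{v}·F 0`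
  have hFVb : ∀ x, ‖F x * exp (-V x)‖ ≤ exp v * F 0 := fun x => by
    rw [Real.norm_eq_abs, abs_of_nonneg (mul_nonneg (hF0 x) (exp_pos _).le)]
    exact (hsw x).1.trans (mul_le_mul_of_nonneg_left (le_zero_of_evenLogConcave hF0 hFe hFlc _) (exp_pos _).le)
  have hFVm : AEStronglyMeasurable (fun x => F x * exp (-V x)) volume :=
    (hFm.mul (measurable_exp.comp hVm.neg)).aestronglyMeasurable
  refine integral_le_of_sandwich volume (pow_nonneg (inv_nonneg.2 (Real.sqrt_nonneg _)) r)
    (fun x => mul_nonneg (mul_nonneg (hF0 x) (exp_pos _).le) (mul_nonneg (exp_pos _).le (exp_pos _).le))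
    (fun x => mul_nonneg (hF0 x) (exp_pos _).le) (fun x => ?_) (fun x => ?_)
    ((integrable_exp_qf_mul_exp_neg_qf hS hQ hdom hδ).bdd_mul hFm.aestronglyMeasurable (Filter.Eventually.of_forall hFb))
    ((integrable_exp_neg_qf hS).bdd_mul hFVm (Filter.Eventually.of_forall hFVb))
    (logConcaveMoment_le hS hQ hdom hδ0 hδ hr hF0 hFm hFe hFlc)
  · -- `A' ≤ e^{v}·A`
    have h := mul_le_mul_of_nonneg_right (hsw x).1 (mul_nonneg (exp_pos (x ⬝ᵥ (Q *ᵥ x))).le (exp_pos (-(x ⬝ᵥ (S *ᵥ x)))).le)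
    simpa only [mul_assoc] using h
  · -- `B ≤ e^{v}·B'`
    have h := mul_le_mul_of_nonneg_right (hsw x).2 (exp_pos (-(x ⬝ᵥ (S *ᵥ x)))).le
    simpa only [mul_assoc] using h

/-- The cost in exponential currency: `e^{2v}·(√(1−δ))⁻¹ ^ r = e^{2v + r·(−log(1−δ)∕2)}`. [folklore] -/
theorem sandwichCost_eq_exp {δ : ℝ} (hδ : δ < 1) (v : ℝ) (r : ℕ) :
    exp (2 * v) * (√(1 - δ))⁻¹ ^ r = exp (2 * v + r * (-Real.log (1 - δ) / 2)) := by
  rw [inv_sqrt_pow_eq_exp hδ, ← exp_add]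

/-- **THE CARRIER OF SUCH KERNELS IS BACKGROUND-UNIFORMLY BOUNDED**: for kernels `F_y·e^{−V_y}·e^{−S_y}` in every background `y`
(data as above, `v` and `δ, r` uniform in `y`), `0 ≤ M y ≤ e^{2v + r·(−log(1−δ)∕2)}` for the carrier
`M y = (∫ F_y e^{−V_y} e^{Q_y} e^{−S_y}) ∕ (∫ F_y e^{−V_y} e^{−S_y})` — the `hM0∕hMb` input of `locCondStability_of_carrier_le`.
[folklore] -/
theorem logConcaveSandwichCarrier_le {Y : Type*} (S Q : Y → Matrix n n ℝ) (F V : Y → (n → ℝ) → ℝ) {δ v : ℝ} {r : ℕ}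
    (hS : ∀ y, (S y).PosDef) (hQ : ∀ y, (Q y).PosSemidef) (hdom : ∀ y, (δ • S y - Q y).PosSemidef) (hδ0 : 0 ≤ δ)
    (hδ : δ < 1) (hr : ∀ y, (Q y).rank ≤ r) (hF0 : ∀ y x, 0 ≤ F y x) (hFm : ∀ y, Measurable (F y))
    (hFe : ∀ y x, F y (-x) = F y x) (hFlc : ∀ y x x', F y x * F y x' ≤ F y ((2 : ℝ)⁻¹ • (x + x')) ^ 2)
    (hVm : ∀ y, Measurable (V y)) (hV : ∀ y x, F y x ≠ 0 → |V y x| ≤ v) (y : Y) :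
    0 ≤ (∫ x, F y x * exp (-V y x) * (exp (x ⬝ᵥ (Q y *ᵥ x)) * exp (-(x ⬝ᵥ (S y *ᵥ x))))) /
        (∫ x, F y x * exp (-V y x) * exp (-(x ⬝ᵥ (S y *ᵥ x)))) ∧
      (∫ x, F y x * exp (-V y x) * (exp (x ⬝ᵥ (Q y *ᵥ x)) * exp (-(x ⬝ᵥ (S y *ᵥ x))))) /
          (∫ x, F y x * exp (-V y x) * exp (-(x ⬝ᵥ (S y *ᵥ x)))) ≤ exp (2 * v + r * (-Real.log (1 - δ) / 2)) := by
  have hN : 0 ≤ ∫ x, F y x * exp (-V y x) * (exp (x ⬝ᵥ (Q y *ᵥ x)) * exp (-(x ⬝ᵥ (S y *ᵥ x)))) :=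
    integral_nonneg fun x => mul_nonneg (mul_nonneg (hF0 y x) (exp_pos _).le) (mul_nonneg (exp_pos _).le (exp_pos _).le)
  have hD : 0 ≤ ∫ x, F y x * exp (-V y x) * exp (-(x ⬝ᵥ (S y *ᵥ x))) :=
    integral_nonneg fun x => mul_nonneg (mul_nonneg (hF0 y x) (exp_pos _).le) (exp_pos _).le
  refine ⟨div_nonneg hN hD, ?_⟩
  rw [← sandwichCost_eq_exp hδ]
  exact div_le_of_le_mul (mul_nonneg (exp_pos _).le (pow_nonneg (inv_nonneg.2 (Real.sqrt_nonneg _)) r)) hD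
    (logConcaveSandwichMoment_le (hS y) (hQ y) (hdom y) hδ0 hδ (hr y) (hF0 y) (hFm y) (hFe y) (hFlc y) (hVm y) (hV y))

end Summit.QuantumFields.BalabanUV.T4Continuum.NE7b.LogConcaveSandwich
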